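import Literature.Claims.NS.PanPan2025
import HarnessLib

/-!
# C97 `PanPan2025` (#103) — ERRATUM-COLUMN kernel refutation of `Step_IV2c` (p.43 d4–d5)

`Literature.Claims.NS.PanPan2025.Step_IV2c` types, as printed, the arithmetic that closes the
contradiction of Ch. Ⅳ §4.2.2 p.43 «For δ > 0, the right-hand side satisfies 2Mδ > M (since
|I_δ| = δ > 0)» — i.e. `∀ M δ : ℝ, 0 < M → 0 < δ → M < 2·M·δ`.  It fails for every `δ ≤ 1/2`;
witness `M = 1`, `δ = 1/4` (`2Mδ = 1/2 < 1 = M`).  OFF the composition path (`claim_of_steps`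
does not consume it; the verdict locator of record is `Step_C1a`, `not_Step_C1a` in
`SoloRefutePanPan2025.lean`) — erratum column only; token #103 / locator / class untouched.
Refuter: ns-claims-refuter-1 g4; filed under convention (b) by a salvage prover.

WHAT THIS IS NOT: not a claim about NS regularity or blow-up; not a claim about any author beyond
the typed locator.
-/

set_option linter.dupNamespace false

namespace Summit.NavierStokesRegularity.NavierStokesRegularity.Theorems.PanPan2025

open Literature.Claims.NS.PanPan2025

/-- **p.43 d4–d5 fails as printed**: `2Mδ > M` is false for `0 < δ ≤ 1/2`; witness `M = 1`,
`δ = 1/4`. [cite: PanPan2025, Ch. Ⅳ §4.2.2 p.43 d4–d5] -/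
theorem not_Step_IV2c : ¬ Step_IV2c := by
  intro h
  have h1 := h 1 (1 / 4) one_pos (by norm_num)
  norm_num at h1

/-- FQN guard: the negated constant is the skeleton's decl. -/
example : ¬ Literature.Claims.NS.PanPan2025.Step_IV2c := not_Step_IV2c

end Summit.NavierStokesRegularity.NavierStokesRegularity.Theorems.PanPan2025
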